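import Mathlib.LinearAlgebra.BilinearForm.Orthogonal
import Summits.ValiantsHypothesis.ValiantsHypothesis.Theorems.SymPencilPerFourInnerRankKernel

/-!
# Route `SymPencil` — inner rank of the `2 | 2` row split of `per_4`: kernel vectors from
# `s` independent radical vectors, `|ι| < 8 + s` squares (`--supports` stmt-ValiantsHypothesis-5674
# `SdcSuperquadratic`; toward the cells `(8, 8, 10)`, `(8, 8, 11)` of the sizes `m = 27, 28`;
# rung currency only)

The dimension count behind `SymPencilPerFourInnerRankKernel.ker_ne_bot_of_radical_pair`, stated
once for any number of radical vectors.  Let `t_r(u, ·)` (`r ∈ ι`) be linear forms on the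
`8`-dimensional `y`-space `K⁴ × K⁴`, `c_r ≠ 0`, and let `w_1, …, w_s` be linearly independent
RADICAL vectors of the pairing `y, y' ↦ Σ_r c_r t_r(u, y) t_r(u, y')`.  If the forms had no common
non-trivial zero, `y ↦ (t_r(u, y))_r` would be injective with an `8`-dimensional image `W ⊆ K^ι`,
and the `s` independent vectors `(t_r(u, w_i))_r` would lie in the orthogonal of `W` for the
NON-DEGENERATE form `⟨x, z⟩_c = Σ_r c_r x_r z_r`, whose dimension is `|ι| - 8`
(`LinearMap.BilinForm.finrank_orthogonal`); so `8 + s ≤ |ι|`.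

* `ker_ne_bot_of_radical_vectors` — `|ι| < 8 + s` and `s` independent radical vectors ⇒ a kernel
  vector.  With `s = 2` (the pair `(k, 0), (0, k)` at a corank-one point of `P(a, b)`) this is the
  nine-square lemma; with `s = 4` (the four vectors `(k, 0), (0, k), (k', 0), (0, k')` at a
  corank-TWO point, `ker P(a,b) = span(k, k')`) it gives kernel vectors for up to ELEVEN squares
  (`ker_ne_bot_of_radical_quadruple`), the first input of `Cruxes/SdcSuperquadratic/INNER-RANK-TEN.md`
  §«d = 10, 11», item 1.
* `finrank_orthogonal_range_eq` — in the injective case the `c`-orthogonal of the image has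
  dimension exactly `|ι| - 8`; for `|ι| = 10` it IS the span of the two radical images
  (`orthogonal_range_eq_span_pair_of_card_eq_ten`): the dichotomy every ten-square argument starts
  from.

Honest framing: linear-algebra lemmas; the ten-square statement (cell `(8,8,10)`), `sdc(per_4) ≥ 25`
/ the window `27 ≤ sdc(per_4) ≤ 29`, the crux `SdcSuperquadratic` and `VP ≠ VNP` are untouched.
No definitions, no named facts. [folklore]
-/

noncomputable section

-- single-conjunct layout: Sub = Summit, duplicated namespace component intended
set_option linter.dupNamespace false

namespace Summit.ValiantsHypothesis.ValiantsHypothesis.Theorems.SymPencilPerFourInnerRankKernelVectors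

open Matrix Finset Module

variable {K : Type*} [Field K] {ι : Type*} [Fintype ι]

/-! ### The weighted dot product `⟨x, z⟩_c = Σ_r c_r x_r z_r` on `K^ι` -/

/-- The weighted dot product as a bilinear form. [folklore] -/
theorem exists_bilinForm_weighted (c : ι → K) :
    ∃ B : LinearMap.BilinForm K (ι → K), ∀ x z, B x z = ∑ r, c r * x r * z r := by
  refine ⟨LinearMap.mk₂ K (fun x z => ∑ r, c r * x r * z r) (fun x x' z => ?_) (fun s x z => ?_)
    (fun x z z' => ?_) (fun s x z => ?_), fun x z => rfl⟩
  · simp only [Pi.add_apply, mul_add, add_mul, Finset.sum_add_distrib]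
  · simp only [Pi.smul_apply, smul_eq_mul, Finset.mul_sum]
    exact Finset.sum_congr rfl fun r _ => by ring
  · simp only [Pi.add_apply, mul_add, Finset.sum_add_distrib]
  · simp only [Pi.smul_apply, smul_eq_mul, Finset.mul_sum]
    exact Finset.sum_congr rfl fun r _ => by ring

/-- The weighted dot product with NON-ZERO weights is non-degenerate. [folklore] -/
theorem nondegenerate_weighted [DecidableEq ι] (c : ι → K) (hc : ∀ r, c r ≠ 0)
    (B : LinearMap.BilinForm K (ι → K)) (hB : ∀ x z, B x z = ∑ r, c r * x r * z r) :
    B.Nondegenerate := by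
  refine ⟨fun m hm => ?_, fun m hm => ?_⟩
  · funext r
    have h := hm (Pi.single r 1)
    rw [hB] at h
    simp only [Pi.single_apply, mul_ite, mul_one, mul_zero, Finset.sum_ite_eq', Finset.mem_univ,
      if_true] at h
    exact (mul_eq_zero.1 h).resolve_left (hc r)
  · funext r
    have h := hm (Pi.single r 1)
    rw [hB] at h
    simp only [Pi.single_apply, mul_ite, mul_one, mul_zero, ite_mul, zero_mul, Finset.sum_ite_eq',
      Finset.mem_univ, if_true] at h
    exact (mul_eq_zero.1 h).resolve_left (hc r)

/-! ### Kernel vectors from independent radical vectors -/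

/-- **Dimension of the orthogonal of the image.**  If the forms `t_r(u, ·)` have no common zero,
the `c`-orthogonal of the image of `y ↦ (t_r(u,y))_r` has dimension `|ι| - 8`. [folklore] -/
theorem finrank_orthogonal_range_eq [DecidableEq ι] (c : ι → K) (hc : ∀ r, c r ≠ 0)
    (B : LinearMap.BilinForm K (ι → K)) (hB : ∀ x z, B x z = ∑ r, c r * x r * z r)
    (t : ι → (((Fin 4 → K) × (Fin 4 → K)) →ₗ[K] ((Fin 4 → K) × (Fin 4 → K)) →ₗ[K] K))
    (u : (Fin 4 → K) × (Fin 4 → K)) (hinj : LinearMap.ker (LinearMap.pi fun r => t r u) = ⊥) :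
    finrank K (B.orthogonal (LinearMap.range (LinearMap.pi fun r => t r u))) + 8 = Fintype.card ι := by
  have hrange : finrank K (LinearMap.range (LinearMap.pi fun r => t r u)) = 8 := by
    rw [LinearMap.finrank_range_of_inj (LinearMap.ker_eq_bot.1 hinj), finrank_prod,
      finrank_fintype_fun_eq_card, Fintype.card_fin]
  have hle : 8 ≤ Fintype.card ι := by
    have h := Submodule.finrank_le (LinearMap.range (LinearMap.pi fun r => t r u))
    rw [hrange, finrank_fintype_fun_eq_card] at h
    exact h
  rw [LinearMap.BilinForm.finrank_orthogonal (nondegenerate_weighted c hc B hB), hrange,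
    finrank_fintype_fun_eq_card]
  omega

/-- **Kernel vectors from `s` independent radical vectors (`|ι| < 8 + s`).**  Let `t_r(u, ·)`
(`r ∈ ι`) be linear forms on `K⁴ × K⁴`, `c_r ≠ 0`, and `w : Fin s → K⁴ × K⁴` linearly independent
with every `w_i` in the radical of `y, y' ↦ Σ_r c_r t_r(u,y) t_r(u,y')`.  If `|ι| < 8 + s` the forms
have a common non-trivial zero. [folklore] -/
theorem ker_ne_bot_of_radical_vectors [DecidableEq ι] {s : ℕ} (hι : Fintype.card ι < 8 + s)
    (c : ι → K) (hc : ∀ r, c r ≠ 0)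
    (t : ι → (((Fin 4 → K) × (Fin 4 → K)) →ₗ[K] ((Fin 4 → K) × (Fin 4 → K)) →ₗ[K] K))
    (u : (Fin 4 → K) × (Fin 4 → K)) (w : Fin s → (Fin 4 → K) × (Fin 4 → K))
    (hw : LinearIndependent K w) (hrad : ∀ i y', ∑ r, c r * t r u (w i) * t r u y' = 0) :
    LinearMap.ker (LinearMap.pi fun r => t r u) ≠ ⊥ := by
  intro hbot
  obtain ⟨B, hB⟩ := exists_bilinForm_weighted (K := K) c
  set Tu : ((Fin 4 → K) × (Fin 4 → K)) →ₗ[K] (ι → K) := LinearMap.pi fun r => t r u with hTu_def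
  have hTu : ∀ y r, Tu y r = t r u y := fun y r => rfl
  -- the images of the radical vectors: independent, inside the orthogonal of the image
  have hind : LinearIndependent K (Tu ∘ w) := hw.map' Tu hbot
  have hsub : Submodule.span K (Set.range (Tu ∘ w)) ≤ B.orthogonal (LinearMap.range Tu) := by
    rw [Submodule.span_le]
    rintro _ ⟨i, rfl⟩
    rw [SetLike.mem_coe, LinearMap.BilinForm.mem_orthogonal_iff]
    rintro _ ⟨y', rfl⟩
    rw [hB, ← hrad i y']
    exact Finset.sum_congr rfl fun r _ => by rw [Function.comp_apply, hTu, hTu]; ring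
  have hs : finrank K (Submodule.span K (Set.range (Tu ∘ w))) = s := by
    rw [finrank_span_eq_card hind, Fintype.card_fin]
  have hle := Submodule.finrank_mono hsub
  have hdim : finrank K (B.orthogonal (LinearMap.range Tu)) + 8 = Fintype.card ι :=
    finrank_orthogonal_range_eq c hc B hB t u hbot
  rw [hs] at hle
  omega

/-- **The nine-square case** (`s = 2`, the statement of
`SymPencilPerFourInnerRankKernel.ker_ne_bot_of_radical_pair` recovered): two independent radical
vectors and `|ι| ≤ 9`. [folklore] -/
theorem ker_ne_bot_of_radical_pair' [DecidableEq ι] (hι : Fintype.card ι ≤ 9) (c : ι → K)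
    (hc : ∀ r, c r ≠ 0)
    (t : ι → (((Fin 4 → K) × (Fin 4 → K)) →ₗ[K] ((Fin 4 → K) × (Fin 4 → K)) →ₗ[K] K))
    (u : (Fin 4 → K) × (Fin 4 → K)) (w₀ w₁ : (Fin 4 → K) × (Fin 4 → K))
    (hw : LinearIndependent K ![w₀, w₁])
    (hrad₀ : ∀ y', ∑ r, c r * t r u w₀ * t r u y' = 0)
    (hrad₁ : ∀ y', ∑ r, c r * t r u w₁ * t r u y' = 0) :
    LinearMap.ker (LinearMap.pi fun r => t r u) ≠ ⊥ :=
  ker_ne_bot_of_radical_vectors (s := 2) (by omega) c hc t u ![w₀, w₁] hw fun i y' => by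
    fin_cases i
    · exact hrad₀ y'
    · exact hrad₁ y'

/-- **The eleven-square case at a corank-two point** (`s = 4`): four independent radical vectors
(`(k,0), (0,k), (k',0), (0,k')` when `ker P(a,b) ⊇ span(k, k')`) and `|ι| ≤ 11` give a kernel
vector — `INNER-RANK-TEN.md` §«d = 10, 11», item 1. [folklore] -/
theorem ker_ne_bot_of_radical_quadruple [DecidableEq ι] (hι : Fintype.card ι ≤ 11) (c : ι → K)
    (hc : ∀ r, c r ≠ 0)
    (t : ι → (((Fin 4 → K) × (Fin 4 → K)) →ₗ[K] ((Fin 4 → K) × (Fin 4 → K)) →ₗ[K] K))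
    (u : (Fin 4 → K) × (Fin 4 → K)) (w : Fin 4 → (Fin 4 → K) × (Fin 4 → K))
    (hw : LinearIndependent K w) (hrad : ∀ i y', ∑ r, c r * t r u (w i) * t r u y' = 0) :
    LinearMap.ker (LinearMap.pi fun r => t r u) ≠ ⊥ :=
  ker_ne_bot_of_radical_vectors (s := 4) (by omega) c hc t u w hw hrad

/-! ### Ten squares: the orthogonal of the image is the span of the radical pair -/

/-- **The ten-square dichotomy.**  With `|ι| = 10`, two independent radical vectors `w₀, w₁` and
NO kernel vector, the `c`-orthogonal of the image of `y ↦ (t_r(u,y))_r` is exactly the span of the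
two images `(t_r(u,w₀))_r, (t_r(u,w₁))_r` (it has dimension `10 - 8 = 2` and contains them): every
`x` with `Σ_r c_r x_r t_r(u, y) = 0` for all `y` is a combination of the two. [folklore] -/
theorem orthogonal_range_eq_span_pair_of_card_eq_ten [DecidableEq ι] (hι : Fintype.card ι = 10)
    (c : ι → K) (hc : ∀ r, c r ≠ 0)
    (B : LinearMap.BilinForm K (ι → K)) (hB : ∀ x z, B x z = ∑ r, c r * x r * z r)
    (t : ι → (((Fin 4 → K) × (Fin 4 → K)) →ₗ[K] ((Fin 4 → K) × (Fin 4 → K)) →ₗ[K] K))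
    (u : (Fin 4 → K) × (Fin 4 → K)) (hinj : LinearMap.ker (LinearMap.pi fun r => t r u) = ⊥)
    (w₀ w₁ : (Fin 4 → K) × (Fin 4 → K)) (hw : LinearIndependent K ![w₀, w₁])
    (hrad₀ : ∀ y', ∑ r, c r * t r u w₀ * t r u y' = 0)
    (hrad₁ : ∀ y', ∑ r, c r * t r u w₁ * t r u y' = 0) :
    B.orthogonal (LinearMap.range (LinearMap.pi fun r => t r u)) =
      Submodule.span K {(LinearMap.pi fun r => t r u) w₀, (LinearMap.pi fun r => t r u) w₁} := by
  set Tu : ((Fin 4 → K) × (Fin 4 → K)) →ₗ[K] (ι → K) := LinearMap.pi fun r => t r u with hTu_def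
  have hTu : ∀ y r, Tu y r = t r u y := fun y r => rfl
  have hind : LinearIndependent K (Tu ∘ ![w₀, w₁]) := hw.map' Tu hinj
  have hset : Set.range (Tu ∘ ![w₀, w₁]) = {Tu w₀, Tu w₁} := by
    ext x
    simp only [Set.mem_range, Function.comp_apply, Set.mem_insert_iff, Set.mem_singleton_iff]
    constructor
    · rintro ⟨i, rfl⟩
      fin_cases i
      · exact Or.inl rfl
      · exact Or.inr rfl
    · rintro (rfl | rfl)
      · exact ⟨0, rfl⟩
      · exact ⟨1, rfl⟩
  have hsub : Submodule.span K {Tu w₀, Tu w₁} ≤ B.orthogonal (LinearMap.range Tu) := by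
    rw [Submodule.span_le]
    have key : ∀ w, (∀ y', ∑ r, c r * t r u w * t r u y' = 0) → Tu w ∈ B.orthogonal (LinearMap.range Tu) := by
      intro w hw'
      rw [LinearMap.BilinForm.mem_orthogonal_iff]
      rintro _ ⟨y', rfl⟩
      rw [hB, ← hw' y']
      exact Finset.sum_congr rfl fun r _ => by rw [hTu, hTu]; ring
    rintro x hx
    simp only [Set.mem_insert_iff, Set.mem_singleton_iff] at hx
    rcases hx with rfl | rfl
    · exact key w₀ hrad₀
    · exact key w₁ hrad₁
  have hs : finrank K (Submodule.span K ({Tu w₀, Tu w₁} : Set (ι → K))) = 2 := by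
    rw [← hset, finrank_span_eq_card hind, Fintype.card_fin]
  have hdim : finrank K (B.orthogonal (LinearMap.range Tu)) + 8 = Fintype.card ι :=
    finrank_orthogonal_range_eq c hc B hB t u hinj
  refine (Submodule.eq_of_le_of_finrank_le hsub ?_).symm
  rw [hs]
  omega

end Summit.ValiantsHypothesis.ValiantsHypothesis.Theorems.SymPencilPerFourInnerRankKernelVectors

end
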